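import Literature.Probability.LatticeModels.MedialInterfaceProofs
import Literature.Probability.LatticeModels.CornerPermutation
import Literature.Probability.LatticeModels.DiscreteFaceBoundary
import Literature.Probability.LatticeModels.IsoradialGraphsProofs
import Literature.Probability.Percolation.LatticeTraceGeometry
import Literature.Probability.RandomPlanarGeometry.PolygonalDomains
import HarnessLib

/-!
# Boundary darts of a finite cell complex of `ℤ²`: the tracing permutation and its simple loops

Topic `Probability/Percolation`.  Support for the gluing theorem (Schramm–Smirnov 2011, Thm 1.5 /
Prop 4.1): the quads met in its proof are unions of closed half-mesh cells (site, bond and face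
cells of the revealed/fresh decomposition), and Lemma 6.1 is applied to them as `Quad`s, i.e. as
closed Jordan domains with four marked boundary arcs.  This file is the first, purely combinatorial
step of "a pinch-free hole-free finite union of closed unit cells is a closed Jordan domain":

* cells are indexed by their lower-left corners (`faceAt v k`, `cornerOff`, `cornerUnit` of
  `MedialInterfaceProofs`); a **boundary dart** `(v, k)` of `U : Finset (Site 2)` is the unit edge
  from `v` in direction `k` with the cell on its left in `U` and the cell on its right not in `U`
  (`IsBd`);
* the **tracing rule** `bdSucc` (at the head: turn right if the cell ahead-right is in `U`, else go
  straight if the cell ahead-left is in `U`, else turn left) maps boundary darts to boundary darts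
  and is a bijection with explicit inverse `bdPred` (`bdPred_bdSucc`, `bdSucc_bdPred`) — no
  hypothesis on `U` is needed for this;
* `PinchFree U` (no vertex sees the checkerboard pattern) gives **at most one outgoing boundary
  dart per vertex** (`snd_eq_of_isBd_of_pinchFree`);
* the orbit of a boundary dart is periodic (`exists_period`), its darts over a minimal period are
  distinct, hence under `PinchFree` its start vertices are distinct (`vert_injOn`), consecutive ones
  differ by unit steps, and the traced vertex list is a **simple closed polygon** in the sense of
  `IsSimpleClosedPolygon` (`isSimpleClosedPolygon_traceList`), ready for `polygonDomain`.

Everything is proved; no named fact is introduced.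

## References

* O. Schramm, S. Smirnov, *On the scaling limits of planar percolation*, Ann. Probab. 39 (2011),
  arXiv:1101.5820, proof of Thm 1.5 ("Let `Q` correspond to the component of `Ω` …").
  [SchrammSmirnov2011]
* G. Grimmett, *Percolation*, 2nd ed. (1999), §11.2 (faces of `ℤ²` by lower-left corners). [GrimmettPercolation1999]
-/

noncomputable section

open Set
open Literature.Probability.LatticeModels
open Literature.Probability.RandomPlanarGeometry

namespace Literature.Probability.Percolation

namespace CellComplex

/-! ### `Fin 4` bookkeeping and the cells around a unit edge -/

/-- `k + 1 + 1 + 1 = k + 3` in `Fin 4`. [folklore] -/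
theorem fin4_one_one_one (k : Fin 4) : k + 1 + 1 + 1 = k + 3 := by revert k; decide

/-- Every `j : Fin 4` is `k + i` for some `i`. [folklore] -/
theorem fin4_exists_add (k j : Fin 4) : ∃ i : Fin 4, j = k + i := ⟨j - k, by abel⟩

/-! ### Boundary darts and the tracing rule -/

variable (U : Finset (Site 2))

/-- **Boundary dart**: the unit edge from `v` in direction `k`, with the cell on its left in `U`
and the cell on its right not in `U`. [folklore] -/
def IsBd (d : Site 2 × Fin 4) : Prop := faceAt d.1 d.2 ∈ U ∧ faceAt d.1 (d.2 + 3) ∉ U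

/-- The head of a dart. [folklore] -/
def head (d : Site 2 × Fin 4) : Site 2 := d.1 + cornerUnit d.2

open scoped Classical in
/-- **The tracing rule** (`U` kept on the left): at the head, turn right if the cell ahead-right is
in `U`, else go straight if the cell ahead-left is in `U`, else turn left. [folklore] -/
def bdSucc (d : Site 2 × Fin 4) : Site 2 × Fin 4 :=
  if faceAt (head d) (d.2 + 3) ∈ U then (head d, d.2 + 3)
  else if faceAt (head d) d.2 ∈ U then (head d, d.2) else (head d, d.2 + 1)

open scoped Classical in
/-- The inverse rule: the dart by which the tracing arrived. [folklore] -/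
def bdPred (d : Site 2 × Fin 4) : Site 2 × Fin 4 :=
  if faceAt d.1 (d.2 + 2) ∈ U then (d.1 - cornerUnit (d.2 + 1), d.2 + 1)
  else if faceAt d.1 (d.2 + 1) ∈ U then (d.1 - cornerUnit d.2, d.2)
  else (d.1 - cornerUnit (d.2 + 3), d.2 + 3)

variable {U}

/-- The successor of a boundary dart is a boundary dart. [folklore] -/
theorem isBd_bdSucc {d : Site 2 × Fin 4} (hd : IsBd U d) : IsBd U (bdSucc U d) := by
  classical
  obtain ⟨v, k⟩ := d
  obtain ⟨hL, hR⟩ := hd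
  simp only at hL hR
  unfold bdSucc
  simp only [head]
  set w := v + cornerUnit k with hw
  have hBL : faceAt w (k + 1) = faceAt v k := faceAt_add_unit_succ v k
  have hBR : faceAt w (k + 2) = faceAt v (k + 3) := faceAt_add_unit_add_two v k
  split_ifs with hb ha
  · refine ⟨hb, ?_⟩
    show faceAt w (k + 3 + 3) ∉ U
    rw [fin4_add_three_add_three, hBR]; exact hR
  · refine ⟨ha, hb⟩
  · refine ⟨?_, ?_⟩
    · show faceAt w (k + 1) ∈ U
      rw [hBL]; exact hL
    · show faceAt w (k + 1 + 3) ∉ U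
      rw [fin4_add_one_add_three]; exact ha

/-- The predecessor of a boundary dart is a boundary dart. [folklore] -/
theorem isBd_bdPred {d : Site 2 × Fin 4} (hd : IsBd U d) : IsBd U (bdPred U d) := by
  classical
  obtain ⟨w, j⟩ := d
  obtain ⟨hL, hR⟩ := hd
  simp only at hL hR
  unfold bdPred
  simp only
  split_ifs with hY hX
  · -- came turning right, from direction `j + 1`
    set v := w - cornerUnit (j + 1) with hv
    have hwv : w = v + cornerUnit (j + 1) := by rw [hv]; abel
    refine ⟨?_, ?_⟩
    · show faceAt v (j + 1) ∈ U
      rw [← faceAt_add_unit_succ v (j + 1), ← hwv, fin4_add_one_add_one]; exact hY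
    · show faceAt v (j + 1 + 3) ∉ U
      rw [← faceAt_add_unit_add_two v (j + 1), ← hwv, fin4_add_one_add_two]; exact hR
  · -- came straight
    set v := w - cornerUnit j with hv
    have hwv : w = v + cornerUnit j := by rw [hv]; abel
    refine ⟨?_, ?_⟩
    · show faceAt v j ∈ U
      rw [← faceAt_add_unit_succ v j, ← hwv]; exact hX
    · show faceAt v (j + 3) ∉ U
      rw [← faceAt_add_unit_add_two v j, ← hwv]; exact hY
  · -- came turning left, from direction `j + 3`
    set v := w - cornerUnit (j + 3) with hv
    have hwv : w = v + cornerUnit (j + 3) := by rw [hv]; abel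
    refine ⟨?_, ?_⟩
    · show faceAt v (j + 3) ∈ U
      rw [← faceAt_add_unit_succ v (j + 3), ← hwv, fin4_add_three_add_one]; exact hL
    · show faceAt v (j + 3 + 3) ∉ U
      rw [← faceAt_add_unit_add_two v (j + 3), ← hwv, DiscreteDobrushin.fin4_three_two]; exact hX

/-- `bdPred ∘ bdSucc = id` on boundary darts. [folklore] -/
theorem bdPred_bdSucc {d : Site 2 × Fin 4} (hd : IsBd U d) : bdPred U (bdSucc U d) = d := by
  classical
  obtain ⟨v, k⟩ := d
  obtain ⟨hL, hR⟩ := hd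
  simp only at hL hR
  have hBL : faceAt (v + cornerUnit k) (k + 1) = faceAt v k := faceAt_add_unit_succ v k
  have hBR : faceAt (v + cornerUnit k) (k + 2) = faceAt v (k + 3) := faceAt_add_unit_add_two v k
  unfold bdSucc
  simp only [head]
  split_ifs with hb ha
  · unfold bdPred
    simp only
    rw [DiscreteDobrushin.fin4_three_two, if_pos (by rw [hBL]; exact hL)]
    refine Prod.ext ?_ (fin4_add_three_add_one k)
    show v + cornerUnit k - cornerUnit (k + 3 + 1) = v
    rw [fin4_add_three_add_one]; abel
  · unfold bdPred
    simp only
    rw [if_neg (by rw [hBR]; exact hR), if_pos (by rw [hBL]; exact hL)]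
    refine Prod.ext ?_ rfl
    show v + cornerUnit k - cornerUnit k = v
    abel
  · unfold bdPred
    simp only
    rw [fin4_add_one_add_two, fin4_add_one_add_one, if_neg hb, if_neg (by rw [hBR]; exact hR)]
    refine Prod.ext ?_ (fin4_add_one_add_three k)
    show v + cornerUnit k - cornerUnit (k + 1 + 3) = v
    rw [fin4_add_one_add_three]; abel

/-- `bdSucc ∘ bdPred = id` on boundary darts. [folklore] -/
theorem bdSucc_bdPred {d : Site 2 × Fin 4} (hd : IsBd U d) : bdSucc U (bdPred U d) = d := by
  classical
  obtain ⟨w, j⟩ := d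
  obtain ⟨hL, hR⟩ := hd
  simp only at hL hR
  unfold bdPred
  simp only
  split_ifs with hY hX
  · set v := w - cornerUnit (j + 1) with hv
    have hwv : v + cornerUnit (j + 1) = w := by rw [hv]; abel
    unfold bdSucc
    simp only [head]
    rw [hwv, fin4_add_one_add_three, if_pos hL]
  · set v := w - cornerUnit j with hv
    have hwv : v + cornerUnit j = w := by rw [hv]; abel
    unfold bdSucc
    simp only [head]
    rw [hwv, if_neg hR, if_pos hL]
  · set v := w - cornerUnit (j + 3) with hv
    have hwv : v + cornerUnit (j + 3) = w := by rw [hv]; abel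
    unfold bdSucc
    simp only [head]
    rw [hwv, fin4_add_three_add_three, if_neg hY, if_neg hR, fin4_add_three_add_one]

/-- The tracing rule is injective on boundary darts. [folklore] -/
theorem bdSucc_injOn : InjOn (bdSucc U) {d | IsBd U d} := fun d hd d' hd' h => by
  rw [← bdPred_bdSucc hd, ← bdPred_bdSucc hd', h]

/-! ### Pinch-freeness: one outgoing boundary dart per vertex -/

/-- **Pinch-free**: no vertex sees the checkerboard pattern (two diagonally opposite cells in `U`,
the other two not). [folklore] -/
def PinchFree (U : Finset (Site 2)) : Prop :=
  ∀ (w : Site 2) (k : Fin 4),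
    ¬ (faceAt w k ∈ U ∧ faceAt w (k + 2) ∈ U ∧ faceAt w (k + 1) ∉ U ∧ faceAt w (k + 3) ∉ U)

/-- Under pinch-freeness a vertex carries at most one outgoing boundary dart. [folklore] -/
theorem snd_eq_of_isBd_of_pinchFree (hP : PinchFree U) {w : Site 2} {j j' : Fin 4}
    (h : IsBd U (w, j)) (h' : IsBd U (w, j')) : j = j' := by
  obtain ⟨hL, hR⟩ := h
  obtain ⟨hL', hR'⟩ := h'
  simp only at hL hR hL' hR'
  obtain ⟨i, rfl⟩ := fin4_exists_add j j'
  fin_cases i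
  · simp
  · exfalso
    simp only [Fin.mk_one] at hR'
    rw [fin4_add_one_add_three] at hR'
    exact hR' hL
  · exfalso
    refine hP w j ⟨hL, ?_, ?_, hR⟩
    · simpa using hL'
    · have : j + 2 + 3 = j + 1 := fin4_add_two_add_three j
      simpa [this] using hR'
  · exfalso
    have : ((3 : Fin 4)) = 3 := rfl
    exact hR (by simpa using hL')

/-- Two boundary darts with the same start vertex are equal (pinch-free). [folklore] -/
theorem eq_of_fst_eq_of_pinchFree (hP : PinchFree U) {d d' : Site 2 × Fin 4} (h : IsBd U d)
    (h' : IsBd U d') (heq : d.1 = d'.1) : d = d' := by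
  obtain ⟨w, j⟩ := d
  obtain ⟨w', j'⟩ := d'
  simp only at heq
  subst heq
  rw [snd_eq_of_isBd_of_pinchFree hP h h']

/-! ### The orbit of a boundary dart -/

variable (U) in
/-- The orbit of `d₀` under the tracing rule. [folklore] -/
def bdOrbit (d₀ : Site 2 × Fin 4) (n : ℕ) : Site 2 × Fin 4 := (bdSucc U)^[n] d₀

/-- `bdOrbit 0`. [folklore] -/
@[simp] theorem bdOrbit_zero (d₀ : Site 2 × Fin 4) : bdOrbit U d₀ 0 = d₀ := rfl

/-- `bdOrbit (n+1)`. [folklore] -/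
theorem bdOrbit_succ (d₀ : Site 2 × Fin 4) (n : ℕ) :
    bdOrbit U d₀ (n + 1) = bdSucc U (bdOrbit U d₀ n) := by
  simp only [bdOrbit, Function.iterate_succ_apply']

/-- `bdOrbit (m + n)`. [folklore] -/
theorem bdOrbit_add (d₀ : Site 2 × Fin 4) (m n : ℕ) :
    bdOrbit U d₀ (m + n) = bdOrbit U (bdOrbit U d₀ m) n := by
  simp only [bdOrbit, ← Function.iterate_add_apply, add_comm]

/-- All darts of the orbit of a boundary dart are boundary darts. [folklore] -/
theorem isBd_bdOrbit {d₀ : Site 2 × Fin 4} (h₀ : IsBd U d₀) (n : ℕ) : IsBd U (bdOrbit U d₀ n) := by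
  induction n with
  | zero => exact h₀
  | succ n ih => rw [bdOrbit_succ]; exact isBd_bdSucc ih

/-- Boundary darts form a finite set (their left cell is in `U`). [folklore] -/
theorem finite_isBd : {d : Site 2 × Fin 4 | IsBd U d}.Finite := by
  classical
  have : {d : Site 2 × Fin 4 | IsBd U d} ⊆
      ((U ×ˢ (Finset.univ : Finset (Fin 4))).image fun p => (p.1 + cornerOff p.2, p.2) : Finset _) := by
    rintro ⟨v, k⟩ ⟨hL, -⟩
    simp only [Finset.coe_image, Finset.coe_product, Finset.coe_univ, mem_image, mem_prod,
      mem_univ, and_true, Prod.exists, Prod.mk.injEq]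
    exact ⟨faceAt v k, k, hL, by simp [faceAt], rfl⟩
  exact (Finset.finite_toSet _).subset this

/-- **Periodicity**: the orbit of a boundary dart returns to it. [folklore] -/
theorem exists_period {d₀ : Site 2 × Fin 4} (h₀ : IsBd U d₀) : ∃ P, 0 < P ∧ bdOrbit U d₀ P = d₀ := by
  have hmaps : ∀ n, bdOrbit U d₀ n ∈ {d : Site 2 × Fin 4 | IsBd U d} := fun n => isBd_bdOrbit h₀ n
  obtain ⟨m, n, hmn, heq⟩ := finite_isBd.exists_lt_map_eq_of_forall_mem hmaps
  refine ⟨n - m, Nat.sub_pos_of_lt hmn, ?_⟩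
  -- cancel `m` applications of the injective rule
  have key : ∀ i ≤ m, bdOrbit U d₀ (m - i) = bdOrbit U d₀ (n - i) := by
    intro i hi
    induction i with
    | zero => simpa using heq
    | succ i ih =>
      have him : i ≤ m := Nat.le_of_succ_le hi
      have h1 : bdOrbit U d₀ (m - i) = bdSucc U (bdOrbit U d₀ (m - (i + 1))) := by
        rw [← bdOrbit_succ]; congr 1; omega
      have h2 : bdOrbit U d₀ (n - i) = bdSucc U (bdOrbit U d₀ (n - (i + 1))) := by
        rw [← bdOrbit_succ]; congr 1; omega
      have := ih him
      rw [h1, h2] at this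
      exact bdSucc_injOn (isBd_bdOrbit h₀ _) (isBd_bdOrbit h₀ _) this
  have := key m le_rfl
  simpa using this.symm

section Period

variable {d₀ : Site 2 × Fin 4} (h₀ : IsBd U d₀)

open scoped Classical in
/-- The minimal period of the orbit. [folklore] -/
def period (h₀ : IsBd U d₀) : ℕ := Nat.find (exists_period h₀)

/-- The minimal period is positive. [folklore] -/
theorem period_pos : 0 < period h₀ := by
  classical
  exact (Nat.find_spec (exists_period h₀)).1

/-- The orbit closes up after the minimal period. [folklore] -/
theorem bdOrbit_period : bdOrbit U d₀ (period h₀) = d₀ := by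
  classical
  exact (Nat.find_spec (exists_period h₀)).2

/-- No shorter positive period. [folklore] -/
theorem bdOrbit_ne_of_lt_period {n : ℕ} (hn0 : 0 < n) (hn : n < period h₀) : bdOrbit U d₀ n ≠ d₀ := by
  classical
  intro h
  exact Nat.find_min (exists_period h₀) hn ⟨hn0, h⟩

/-- The orbit is periodic. [folklore] -/
theorem bdOrbit_add_period (n : ℕ) : bdOrbit U d₀ (n + period h₀) = bdOrbit U d₀ n := by
  rw [add_comm, bdOrbit_add, bdOrbit_period]

/-- The orbit reduced modulo the period. [folklore] -/
theorem bdOrbit_mod (n : ℕ) : bdOrbit U d₀ (n % period h₀) = bdOrbit U d₀ n := by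
  conv_rhs => rw [← Nat.mod_add_div n (period h₀)]
  generalize n / period h₀ = q
  induction q with
  | zero => simp
  | succ q ih => rw [Nat.mul_succ, ← add_assoc, bdOrbit_add_period, ih]

/-- **The darts over a minimal period are distinct.** [folklore] -/
theorem bdOrbit_injOn : InjOn (bdOrbit U d₀) (Iio (period h₀)) := by
  -- it suffices to treat `i < j`
  suffices H : ∀ i j : ℕ, i < period h₀ → j < period h₀ → bdOrbit U d₀ i = bdOrbit U d₀ j → i < j →
      False by
    intro i hi j hj hij
    simp only [mem_Iio] at hi hj
    rcases lt_trichotomy i j with h | h | h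
    · exact absurd h (fun h' => H i j hi hj hij h')
    · exact h
    · exact absurd h (fun h' => H j i hj hi hij.symm h')
  intro i j hi hj hij hlt
  -- `orbit (j - i) = d₀` by cancelling `i` steps
  have key : ∀ t ≤ i, bdOrbit U d₀ (i - t) = bdOrbit U d₀ (j - t) := by
    intro t ht
    induction t with
    | zero => simpa using hij
    | succ t ih =>
      have htm : t ≤ i := Nat.le_of_succ_le ht
      have h1 : bdOrbit U d₀ (i - t) = bdSucc U (bdOrbit U d₀ (i - (t + 1))) := by
        rw [← bdOrbit_succ]; congr 1; omega
      have h2 : bdOrbit U d₀ (j - t) = bdSucc U (bdOrbit U d₀ (j - (t + 1))) := by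
        rw [← bdOrbit_succ]; congr 1; omega
      have := ih htm
      rw [h1, h2] at this
      exact bdSucc_injOn (isBd_bdOrbit h₀ _) (isBd_bdOrbit h₀ _) this
  have := key i le_rfl
  simp only [Nat.sub_self, bdOrbit_zero] at this
  exact bdOrbit_ne_of_lt_period h₀ (Nat.sub_pos_of_lt hlt) (by omega) this.symm

/-! ### The traced vertices -/

variable (U d₀) in
/-- The start vertex of the `i`-th dart. [folklore] -/
def vert (i : ℕ) : Site 2 := (bdOrbit U d₀ i).1

variable (U d₀) in
/-- The direction of the `i`-th dart. [folklore] -/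
def dirAt (i : ℕ) : Fin 4 := (bdOrbit U d₀ i).2

/-- Consecutive vertices differ by the unit step of the dart. [folklore] -/
theorem vert_succ (i : ℕ) : vert U d₀ (i + 1) = vert U d₀ i + cornerUnit (dirAt U d₀ i) := by
  classical
  simp only [vert, dirAt, bdOrbit_succ]
  unfold bdSucc
  split_ifs <;> rfl

/-- Vertices are periodic. [folklore] -/
theorem vert_mod (i : ℕ) : vert U d₀ (i % period h₀) = vert U d₀ i := by
  simp only [vert, bdOrbit_mod h₀]

/-- **Under pinch-freeness the vertices over a minimal period are distinct.** [folklore] -/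
theorem vert_injOn (hP : PinchFree U) : InjOn (vert U d₀) (Iio (period h₀)) := by
  intro i hi j hj hij
  exact bdOrbit_injOn h₀ hi hj
    (eq_of_fst_eq_of_pinchFree hP (isBd_bdOrbit h₀ i) (isBd_bdOrbit h₀ j) hij)

/-- The orbit never traverses an edge back and forth: if the `j`-th dart starts at the head of the
`i`-th dart and points backwards, its left cell would be the right cell of the `i`-th dart.
[folklore] -/
theorem not_backtrack (h₀ : IsBd U d₀) (i j : ℕ)
    (hv : vert U d₀ j = vert U d₀ i + cornerUnit (dirAt U d₀ i))
    (hd : dirAt U d₀ j = dirAt U d₀ i + 2) : False := by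
  have hi := isBd_bdOrbit h₀ i
  have hj := isBd_bdOrbit h₀ j
  obtain ⟨hLj, -⟩ := hj
  obtain ⟨-, hRi⟩ := hi
  change faceAt (vert U d₀ j) (dirAt U d₀ j) ∈ U at hLj
  change faceAt (vert U d₀ i) (dirAt U d₀ i + 3) ∉ U at hRi
  rw [hv, hd, faceAt_add_unit_add_two] at hLj
  exact hRi hLj

end Period

/-! ### Lattice points and unit steps in the plane -/

/-- The four unit steps in the plane: `1, i, -1, -i`. [folklore] -/
theorem toComplex_cornerUnit_table (k : Fin 4) :
    Site.toComplex (cornerUnit k) = match k with | 0 => 1 | 1 => Complex.I | 2 => -1 | 3 => -Complex.I := by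
  fin_cases k <;> apply Complex.ext <;> simp [Site.toComplex, cornerUnit]

/-- Unit steps are nonzero in the plane. [folklore] -/
theorem toComplex_cornerUnit_ne_zero (k : Fin 4) : Site.toComplex (cornerUnit k) ≠ 0 := by
  rw [toComplex_cornerUnit_table]
  fin_cases k <;> simp [Complex.ext_iff]

/-- A point of the half-open unit edge `[v, v + u_k)` in coordinates. [folklore] -/
theorem mem_icoSegment_toC_iff {v : Site 2} {k : Fin 4} {p : ℂ} :
    p ∈ icoSegment (Site.toComplex v) (Site.toComplex (v + cornerUnit k)) ↔
      ∃ t : ℝ, 0 ≤ t ∧ t < 1 ∧ p = Site.toComplex v + (t : ℂ) * Site.toComplex (cornerUnit k) := by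
  simp only [icoSegment, mem_image, mem_Ico, AffineMap.lineMap_apply_module', toComplex_add]
  constructor
  · rintro ⟨t, ⟨h0, h1⟩, rfl⟩
    refine ⟨t, h0, h1, ?_⟩
    simp only [add_sub_cancel_left, Complex.real_smul]
    ring
  · rintro ⟨t, h0, h1, rfl⟩
    refine ⟨t, ⟨h0, h1⟩, ?_⟩
    simp only [add_sub_cancel_left, Complex.real_smul]
    ring

/-- Integer plus fractional parts: `a + t = b + s` with `t, s ∈ [0,1)` forces `a = b`. [folklore] -/
theorem int_eq_of_add_frac_eq {a b : ℤ} {t s : ℝ} (ht : 0 ≤ t) (ht1 : t < 1) (hs : 0 ≤ s) (hs1 : s < 1)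
    (h : (a : ℝ) + t = b + s) : a = b := by
  have h1 : ((a : ℝ) - b) = s - t := by linarith
  have h2 : |((a - b : ℤ) : ℝ)| < 1 := by push_cast; rw [h1, abs_lt]; constructor <;> linarith
  have : a - b = 0 := by exact_mod_cast Int.abs_lt_one_iff.1 (by exact_mod_cast h2)
  omega

/-- `a + t = b` with `t ∈ [0,1)` forces `t = 0` and `a = b`. [folklore] -/
theorem int_eq_of_add_frac_eq_int {a b : ℤ} {t : ℝ} (ht : 0 ≤ t) (ht1 : t < 1)
    (h : (a : ℝ) + t = b) : a = b ∧ t = 0 := by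
  have := int_eq_of_add_frac_eq ht ht1 le_rfl zero_lt_one (by simpa using h)
  subst this
  exact ⟨rfl, by linarith⟩

/-- `a + t = b - s` with `t, s ∈ [0,1)`: either both vanish and `a = b`, or `b = a + 1`.
[folklore] -/
theorem int_cases_of_add_frac_eq_sub_frac {a b : ℤ} {t s : ℝ} (ht : 0 ≤ t) (ht1 : t < 1)
    (hs : 0 ≤ s) (hs1 : s < 1) (h : (a : ℝ) + t = b - s) :
    (a = b ∧ t = 0 ∧ s = 0) ∨ b = a + 1 := by
  have h1 : ((b : ℝ) - a) = t + s := by linarith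
  have hlt : ((b - a : ℤ) : ℝ) < 2 := by push_cast; rw [h1]; linarith
  have hge : (0 : ℝ) ≤ ((b - a : ℤ) : ℝ) := by push_cast; rw [h1]; linarith
  have hlt' : b - a < 2 := by exact_mod_cast hlt
  have hge' : 0 ≤ b - a := by exact_mod_cast hge
  rcases (show b - a = 0 ∨ b - a = 1 by omega) with h0 | h0
  · left
    have hab : a = b := by omega
    subst hab
    have : t + s = 0 := by have := h1; simp at this; linarith
    exact ⟨rfl, by linarith, by linarith⟩
  · right; omega

/-- **Two half-open unit edges of `ℤ²` meet only trivially**: if `[v, v+u_k)` and `[v', v'+u_{k'})`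
share a point then either they start at the same vertex, or the second one is the first one
reversed (`v' = v + u_k`, `k' = k + 2`), or symmetrically. [folklore] -/
theorem icoSegment_cases {v v' : Site 2} {k k' : Fin 4} {p : ℂ}
    (hp : p ∈ icoSegment (Site.toComplex v) (Site.toComplex (v + cornerUnit k)))
    (hp' : p ∈ icoSegment (Site.toComplex v') (Site.toComplex (v' + cornerUnit k'))) :
    v = v' ∨ (v' = v + cornerUnit k ∧ k' = k + 2) ∨ (v = v' + cornerUnit k' ∧ k = k' + 2) := by
  obtain ⟨t, ht0, ht1, rfl⟩ := mem_icoSegment_toC_iff.1 hp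
  obtain ⟨s, hs0, hs1, heq⟩ := mem_icoSegment_toC_iff.1 hp'
  have hv : ∀ w : Site 2, ∀ j : Fin 4, w = v' ↔ (w 0 = v' 0 ∧ w 1 = v' 1) := fun w j =>
    ⟨fun h => by subst h; exact ⟨rfl, rfl⟩, fun h => by funext i; fin_cases i <;> simp [h.1, h.2]⟩
  have hunit : ∀ (w : Site 2) (j : Fin 4), w + cornerUnit j =
      (match j with
        | 0 => fun i => if i = 0 then w 0 + 1 else w 1
        | 1 => fun i => if i = 0 then w 0 else w 1 + 1
        | 2 => fun i => if i = 0 then w 0 - 1 else w 1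
        | 3 => fun i => if i = 0 then w 0 else w 1 - 1) := by
    intro w j
    fin_cases j <;> funext i <;> fin_cases i <;> simp [cornerUnit] <;> ring
  rw [Complex.ext_iff] at heq
  obtain ⟨hre, him⟩ := heq
  fin_cases k <;> fin_cases k' <;> norm_num [toComplex_cornerUnit_table] at hre him
  -- 16 cases of integer/fractional bookkeeping
  · -- (0,0)
    left
    have h0 := int_eq_of_add_frac_eq ht0 ht1 hs0 hs1 (a := v 0) (b := v' 0) (by linarith [hre])
    rw [hv v 0]; exact ⟨h0, by exact_mod_cast him⟩
  · -- (0,1)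
    left
    have h0 := int_eq_of_add_frac_eq_int ht0 ht1 (a := v 0) (b := v' 0) (by linarith [hre])
    have h1 := int_eq_of_add_frac_eq_int hs0 hs1 (a := v' 1) (b := v 1) (by linarith [him])
    rw [hv v 0]; exact ⟨h0.1, h1.1.symm⟩
  · -- (0,2): possibly reversed
    have him' : v 1 = v' 1 := by exact_mod_cast him
    rcases int_cases_of_add_frac_eq_sub_frac ht0 ht1 hs0 hs1 (a := v 0) (b := v' 0) (by linarith [hre])
      with ⟨h0, -, -⟩ | h0
    · left; rw [hv v 0]; exact ⟨h0, him'⟩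
    · right; left
      refine ⟨?_, rfl⟩
      rw [hunit]
      funext i; fin_cases i <;> simp [h0, him']
  · -- (0,3)
    left
    have h1 := int_cases_of_add_frac_eq_sub_frac (le_refl (0:ℝ)) zero_lt_one hs0 hs1
      (a := v 1) (b := v' 1) (by linarith [him])
    have h0 := int_eq_of_add_frac_eq_int ht0 ht1 (a := v 0) (b := v' 0) (by linarith [hre])
    rcases h1 with ⟨h1, -, -⟩ | h1
    · rw [hv v 0]; exact ⟨h0.1, h1⟩
    · exfalso
      have := h0.2; subst this
      have h1' : (v' 1 : ℝ) = v 1 + 1 := by exact_mod_cast h1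
      linarith
  · -- (1,0)
    left
    have h0 := int_eq_of_add_frac_eq_int hs0 hs1 (a := v' 0) (b := v 0) (by linarith [hre])
    have h1 := int_eq_of_add_frac_eq_int ht0 ht1 (a := v 1) (b := v' 1) (by linarith [him])
    rw [hv v 0]; exact ⟨h0.1.symm, h1.1⟩
  · -- (1,1)
    left
    have h1 := int_eq_of_add_frac_eq ht0 ht1 hs0 hs1 (a := v 1) (b := v' 1) (by linarith [him])
    rw [hv v 0]; exact ⟨by exact_mod_cast hre, h1⟩
  · -- (1,2)
    left
    have h1 := int_eq_of_add_frac_eq_int ht0 ht1 (a := v 1) (b := v' 1) (by linarith [him])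
    have h0 := int_cases_of_add_frac_eq_sub_frac (le_refl (0:ℝ)) zero_lt_one hs0 hs1
      (a := v 0) (b := v' 0) (by linarith [hre])
    rcases h0 with ⟨h0, -, -⟩ | h0
    · rw [hv v 0]; exact ⟨h0, h1.1⟩
    · exfalso
      have := h1.2; subst this
      have h0' : (v' 0 : ℝ) = v 0 + 1 := by exact_mod_cast h0
      linarith
  · -- (1,3): possibly reversed
    have hre' : v 0 = v' 0 := by exact_mod_cast hre
    rcases int_cases_of_add_frac_eq_sub_frac ht0 ht1 hs0 hs1 (a := v 1) (b := v' 1) (by linarith [him])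
      with ⟨h1, -, -⟩ | h1
    · left; rw [hv v 0]; exact ⟨hre', h1⟩
    · right; left
      refine ⟨?_, rfl⟩
      rw [hunit]
      funext i; fin_cases i <;> simp [h1, hre']
  · -- (2,0): possibly reversed (symmetric)
    have him' : v 1 = v' 1 := by exact_mod_cast him
    rcases int_cases_of_add_frac_eq_sub_frac hs0 hs1 ht0 ht1 (a := v' 0) (b := v 0)
      (by linarith [hre]) with ⟨h0, -, -⟩ | h0
    · left; rw [hv v 0]; exact ⟨h0.symm, him'⟩
    · right; right
      refine ⟨?_, rfl⟩
      rw [hunit]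
      funext i; fin_cases i <;> simp [h0, him']
  · -- (2,1)
    left
    have h1 := int_eq_of_add_frac_eq_int hs0 hs1 (a := v' 1) (b := v 1) (by linarith [him])
    have h0 := int_cases_of_add_frac_eq_sub_frac (le_refl (0:ℝ)) zero_lt_one ht0 ht1
      (a := v' 0) (b := v 0) (by linarith [hre])
    rcases h0 with ⟨h0, -, -⟩ | h0
    · rw [hv v 0]; exact ⟨h0.symm, h1.1.symm⟩
    · exfalso
      have := h1.2; subst this
      have h0' : (v 0 : ℝ) = v' 0 + 1 := by exact_mod_cast h0
      linarith
  · -- (2,2)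
    left
    have h0 := int_eq_of_add_frac_eq hs0 hs1 ht0 ht1 (a := v 0) (b := v' 0) (by linarith [hre])
    have him' : v 1 = v' 1 := by exact_mod_cast him
    rw [hv v 0]; exact ⟨h0, him'⟩
  · -- (2,3)
    left
    have h0' := int_eq_of_add_frac_eq_int ht0 ht1 (a := v' 0) (b := v 0) (by linarith [hre])
    have h1' := int_eq_of_add_frac_eq_int hs0 hs1 (a := v 1) (b := v' 1) (by linarith [him])
    rw [hv v 0]; exact ⟨h0'.1.symm, h1'.1⟩
  · -- (3,0)
    left
    have h0' := int_eq_of_add_frac_eq_int hs0 hs1 (a := v' 0) (b := v 0) (by linarith [hre])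
    have h1' := int_eq_of_add_frac_eq_int ht0 ht1 (a := v' 1) (b := v 1) (by linarith [him])
    rw [hv v 0]; exact ⟨h0'.1.symm, h1'.1.symm⟩
  · -- (3,1): possibly reversed (symmetric)
    have hre' : v 0 = v' 0 := by exact_mod_cast hre
    rcases int_cases_of_add_frac_eq_sub_frac hs0 hs1 ht0 ht1 (a := v' 1) (b := v 1)
      (by linarith [him]) with ⟨h1, -, -⟩ | h1
    · left; rw [hv v 0]; exact ⟨hre', h1.symm⟩
    · right; right
      refine ⟨?_, rfl⟩
      rw [hunit]
      funext i; fin_cases i <;> simp [h1, hre']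
  · -- (3,2)
    left
    have h1' := int_eq_of_add_frac_eq_int ht0 ht1 (a := v' 1) (b := v 1) (by linarith [him])
    have h0c := int_cases_of_add_frac_eq_sub_frac (le_refl (0:ℝ)) zero_lt_one hs0 hs1
      (a := v 0) (b := v' 0) (by linarith [hre])
    rcases h0c with ⟨h0', -, -⟩ | h0'
    · rw [hv v 0]; exact ⟨h0', h1'.1.symm⟩
    · exfalso
      have := h1'.2; subst this
      have h0'' : (v' 0 : ℝ) = v 0 + 1 := by exact_mod_cast h0'
      linarith
  · -- (3,3)
    left
    have h1 := int_eq_of_add_frac_eq hs0 hs1 ht0 ht1 (a := v 1) (b := v' 1) (by linarith [him])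
    have hre' : v 0 = v' 0 := by exact_mod_cast hre
    rw [hv v 0]; exact ⟨hre', h1⟩

/-! ### The traced list is a simple closed polygon -/

section Trace

variable {d₀ : Site 2 × Fin 4} (h₀ : IsBd U d₀)

variable (U d₀) in
/-- The traced vertex list over one minimal period, as points of the plane. [folklore] -/
def traceList (h₀ : IsBd U d₀) : List ℂ := (List.range (period h₀)).map fun i => Site.toComplex (vert U d₀ i)

/-- Length of the traced list. [folklore] -/
@[simp] theorem length_traceList : (traceList U d₀ h₀).length = period h₀ := by
  simp [traceList]

/-- Entries of the traced list. [folklore] -/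
theorem getElem_traceList {i : ℕ} (hi : i < (traceList U d₀ h₀).length) :
    (traceList U d₀ h₀)[i] = Site.toComplex (vert U d₀ i) := by
  simp [traceList]

/-- The next entry, cyclically. [folklore] -/
theorem getElem_traceList_succ_mod {i : ℕ} (_hi : i < period h₀)
    (h : (i + 1) % (traceList U d₀ h₀).length < (traceList U d₀ h₀).length) :
    (traceList U d₀ h₀)[(i + 1) % (traceList U d₀ h₀).length] = Site.toComplex (vert U d₀ (i + 1)) := by
  rw [getElem_traceList]
  simp only [length_traceList]
  rw [vert_mod h₀]

/-- **The traced vertex list of a pinch-free cell complex is a simple closed polygon.** [folklore] -/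
theorem isSimpleClosedPolygon_traceList (hP : PinchFree U) :
    IsSimpleClosedPolygon (traceList U d₀ h₀) := by
  have hP0 := period_pos h₀
  refine IsSimpleClosedPolygon.of_lt (by simpa using hP0) ?_ ?_
  · intro k hk
    have hk' : k < period h₀ := by simpa using hk
    rw [getElem_traceList, getElem_traceList_succ_mod h₀ hk', vert_succ, toComplex_add]
    intro h
    exact toComplex_cornerUnit_ne_zero _ (by simpa using h.symm)
  · intro i j hi hj hij
    have hi' : i < period h₀ := by simpa using hi
    have hj' : j < period h₀ := by simpa using hj
    rw [getElem_traceList, getElem_traceList_succ_mod h₀ hi', getElem_traceList,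
      getElem_traceList_succ_mod h₀ hj', vert_succ, vert_succ]
    rw [Set.disjoint_left]
    intro p hp hp'
    rcases icoSegment_cases hp hp' with h | ⟨hv, hd⟩ | ⟨hv, hd⟩
    · exact absurd (vert_injOn h₀ hP (mem_Iio.2 hi') (mem_Iio.2 hj') h) (ne_of_lt hij)
    · exact not_backtrack h₀ i j hv hd
    · exact not_backtrack h₀ j i hv hd

end Trace

end CellComplex

end Literature.Probability.Percolation

end
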